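import Mathlib
import Literature.Geometry.Lorentzian.BilinPullbackEstimates
import HarnessLib

/-!
# BilinPullbackNearIdConst

Topic `Literature/Uncategorized`. Named literature fact(s) relocated by the gate from `Summits/FinalStateConjecture/FinalStateConjecture/Theorems/StarvedNecksNeckGapDecayStubBilinPullbackNearIdConst.lean`
(accept-time relocation of `[cite]`d propositions written inline in a Summits proposal; human ruling 2026-08-15).

* `Literature.Uncategorized.BilinPullbackNearIdConst`
-/

namespace Literature.Uncategorized

open Set Filter Topology Literature.Geometry.Lorentzian

/-- **W2 — pull-back of a CONSTANT form along a `C³`-near-identity map** (analysis on `E4`).  For a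
constant field `y ↦ β` and `S = id + P` with `P` of class `C³` on an open `U ∋ x` and
`‖Dʲ P(x)‖ ≤ ε ≤ 1` (`j = 1, 2, 3`): `‖Dᵐ (bilinPullback S β − β)(x)‖ ≤ 8 ‖β‖ ε` for `m ≤ 2`.
(With `DS = I + Q`, `Q = DP`: `bilinPullback S β − β = precomp(Q)∘β + β∘Q + precomp(Q)∘β∘Q`,
linear/linear/bilinear in `Q`; `‖Dʲ Q(x)‖ = ‖Dʲ⁺¹ P(x)‖`, `norm_iteratedFDeriv_fderiv_of_isOpen`;
Leibniz `norm_iteratedFDeriv_clm_comp_le`.) [folklore] -/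
def BilinPullbackNearIdConst : Prop :=
  ∀ (β : E4 →L[ℝ] E4 →L[ℝ] ℝ) (P : E4 → E4) (U : Set E4) (x : E4) (ε : ℝ),
    IsOpen U → x ∈ U → ContDiffOn ℝ 3 P U → 0 ≤ ε → ε ≤ 1 →
    (∀ j, 1 ≤ j → j ≤ 3 → ‖iteratedFDeriv ℝ j P x‖ ≤ ε) →
    ∀ m, m ≤ 2 →
      ‖iteratedFDeriv ℝ m (fun y ↦ bilinPullback (fun z ↦ z + P z) (fun _ ↦ β) y - β) x‖ ≤ 8 * ‖β‖ * ε

/-! ### Proof (`BilinPullbackNearIdConst_holds`)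

The folklore Leibniz/chain-rule computation, carried out over an arbitrary real normed space `E`
and then specialised to `E4`.  Write `L := DP` and use the two FIXED continuous linear maps
`Φ := (compL ℝ E E ℝ).flip` (`Φ M = precomp M`, `‖Φ‖ ≤ 1`, cf. `precomp_eq_flip_compL`) and
`Ψ := β.postcomp E` (`Ψ M = β ∘ M`, `‖Ψ‖ ≤ ‖β‖`, `ContinuousLinearMap.norm_postcomp_le`).  Where `P`
is differentiable, `D(id + P) = I + L` and
`bilinPullback (id + P) β − β = (Φ L) ∘ β + Ψ L + (Φ L) ∘ (Ψ L)`
(`(v, w) ↦ β v (L w) + β (L v) w + β (L v) (L w)`).  Since `‖Dʲ L(x)‖ = ‖Dʲ⁺¹ P(x)‖ ≤ ε`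
(`norm_iteratedFDeriv_fderiv_of_isOpen`), `‖Dʲ (Φ ∘ L)(x)‖ ≤ ε` and `‖Dʲ (Ψ ∘ L)(x)‖ ≤ ‖β‖ ε`; the
Leibniz bound `norm_iteratedFDeriv_clm_comp_le` then gives `‖Dᵐ((Φ L) ∘ β)(x)‖ ≤ ‖β‖ ε` (the second
factor is constant, only one term survives) and `‖Dᵐ((Φ L) ∘ (Ψ L))(x)‖ ≤ ∑ C(m,i) ε ‖β‖ ε
= 2ᵐ ‖β‖ ε² ≤ 4 ‖β‖ ε` for `m ≤ 2`, `ε ≤ 1`.  Total `6 ‖β‖ ε ≤ 8 ‖β‖ ε`.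
-/

section NearIdentity

variable {E : Type*} [NormedAddCommGroup E] [NormedSpace ℝ E]

/-- `M ↦ precomp M` after `L`: `‖Dʲ(Φ ∘ L)(x)‖ ≤ ‖Dʲ L(x)‖ ≤ ε` since `‖Φ‖ ≤ 1`. [folklore] -/
private theorem norm_iteratedFDeriv_precomp_comp_le {L : E → E →L[ℝ] E} {U : Set E} {x : E}
    {ε : ℝ} (hU : IsOpen U) (hx : x ∈ U) (hL : ContDiffOn ℝ (2 : ℕ) L U)
    (hLb : ∀ j, j ≤ 2 → ‖iteratedFDeriv ℝ j L x‖ ≤ ε) {j : ℕ} (hj : j ≤ 2) :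
    ‖iteratedFDeriv ℝ j ((ContinuousLinearMap.compL ℝ E E ℝ).flip ∘ L) x‖ ≤ ε := by
  rw [ContinuousLinearMap.iteratedFDeriv_comp_left _ (hL.contDiffAt (hU.mem_nhds hx))
    (by exact_mod_cast hj)]
  refine (ContinuousLinearMap.norm_compContinuousMultilinearMap_le _ _).trans ?_
  have h1 : ‖(ContinuousLinearMap.compL ℝ E E ℝ).flip‖ ≤ 1 := by
    rw [ContinuousLinearMap.opNorm_flip]
    exact ContinuousLinearMap.norm_compL_le _ _ _ _
  calc ‖(ContinuousLinearMap.compL ℝ E E ℝ).flip‖ * ‖iteratedFDeriv ℝ j L x‖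
      ≤ 1 * ε := mul_le_mul h1 (hLb j hj) (norm_nonneg _) zero_le_one
    _ = ε := one_mul ε

/-- `M ↦ β ∘ M` after `L`: `‖Dʲ(Ψ ∘ L)(x)‖ ≤ ‖β‖ ‖Dʲ L(x)‖ ≤ ‖β‖ ε` since `‖Ψ‖ ≤ ‖β‖`.
[folklore] -/
private theorem norm_iteratedFDeriv_postcomp_comp_le (β : E →L[ℝ] E →L[ℝ] ℝ)
    {L : E → E →L[ℝ] E} {U : Set E} {x : E} {ε : ℝ} (hU : IsOpen U) (hx : x ∈ U)
    (hL : ContDiffOn ℝ (2 : ℕ) L U) (hLb : ∀ j, j ≤ 2 → ‖iteratedFDeriv ℝ j L x‖ ≤ ε) {j : ℕ}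
    (hj : j ≤ 2) :
    ‖iteratedFDeriv ℝ j ((β.postcomp (σ := RingHom.id ℝ) E) ∘ L) x‖ ≤ ‖β‖ * ε := by
  rw [ContinuousLinearMap.iteratedFDeriv_comp_left _ (hL.contDiffAt (hU.mem_nhds hx))
    (by exact_mod_cast hj)]
  exact (ContinuousLinearMap.norm_compContinuousMultilinearMap_le _ _).trans
    (mul_le_mul (ContinuousLinearMap.norm_postcomp_le β) (hLb j hj) (norm_nonneg _)
      (norm_nonneg β))

/-- The term `y ↦ precomp (L y) ∘ β` (Leibniz with a constant second factor: only the top term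
survives): `‖Dᶜ(x)‖ ≤ ‖β‖ ε`. [folklore] -/
private theorem norm_iteratedFDeriv_precomp_comp_const_le (β : E →L[ℝ] E →L[ℝ] ℝ)
    {L : E → E →L[ℝ] E} {U : Set E} {x : E} {ε : ℝ} (hU : IsOpen U) (hx : x ∈ U)
    (hL : ContDiffOn ℝ (2 : ℕ) L U) (hLb : ∀ j, j ≤ 2 → ‖iteratedFDeriv ℝ j L x‖ ≤ ε) {c : ℕ}
    (hc : c ≤ 2) :
    ‖iteratedFDeriv ℝ c
        (fun y ↦ (((ContinuousLinearMap.compL ℝ E E ℝ).flip ∘ L) y).comp β) x‖ ≤ ‖β‖ * ε := by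
  have hΦL : ContDiffOn ℝ (2 : ℕ) ((ContinuousLinearMap.compL ℝ E E ℝ).flip ∘ L) U :=
    (ContinuousLinearMap.contDiff _).comp_contDiffOn hL
  refine (norm_iteratedFDeriv_clm_comp_le (Q := fun _ ↦ β) hU hΦL contDiffOn_const hx hc).trans
    ?_
  rw [Finset.sum_range_succ, Finset.sum_eq_zero (fun i hi ↦ ?_), zero_add, Nat.choose_self,
    Nat.cast_one, one_mul, Nat.sub_self, norm_iteratedFDeriv_zero, mul_comm]
  · exact mul_le_mul_of_nonneg_left (norm_iteratedFDeriv_precomp_comp_le hU hx hL hLb hc)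
      (norm_nonneg β)
  · have hi' : i < c := Finset.mem_range.mp hi
    rw [iteratedFDeriv_const_of_ne (by omega), Pi.zero_apply, norm_zero, mul_zero]

/-- The term `y ↦ precomp (L y) ∘ (β ∘ L y)`, bilinear in `L` (Leibniz):
`‖Dᶜ(x)‖ ≤ ∑ C(c, i) ε ‖β‖ ε = 2ᶜ ‖β‖ ε² ≤ 4 ‖β‖ ε` for `c ≤ 2`, `0 ≤ ε ≤ 1`. [folklore] -/
private theorem norm_iteratedFDeriv_precomp_comp_postcomp_le (β : E →L[ℝ] E →L[ℝ] ℝ)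
    {L : E → E →L[ℝ] E} {U : Set E} {x : E} {ε : ℝ} (hU : IsOpen U) (hx : x ∈ U)
    (hL : ContDiffOn ℝ (2 : ℕ) L U) (hε0 : 0 ≤ ε) (hε1 : ε ≤ 1)
    (hLb : ∀ j, j ≤ 2 → ‖iteratedFDeriv ℝ j L x‖ ≤ ε) {c : ℕ} (hc : c ≤ 2) :
    ‖iteratedFDeriv ℝ c (fun y ↦ (((ContinuousLinearMap.compL ℝ E E ℝ).flip ∘ L) y).comp
        (((β.postcomp (σ := RingHom.id ℝ) E) ∘ L) y)) x‖ ≤ 4 * ‖β‖ * ε := by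
  have hΦL : ContDiffOn ℝ (2 : ℕ) ((ContinuousLinearMap.compL ℝ E E ℝ).flip ∘ L) U :=
    (ContinuousLinearMap.contDiff _).comp_contDiffOn hL
  have hΨL : ContDiffOn ℝ (2 : ℕ) ((β.postcomp (σ := RingHom.id ℝ) E) ∘ L) U :=
    (ContinuousLinearMap.contDiff _).comp_contDiffOn hL
  refine (norm_iteratedFDeriv_clm_comp_le hU hΦL hΨL hx hc).trans ?_
  have hterm : ∀ i ∈ Finset.range (c + 1),
      (c.choose i : ℝ) *
            ‖iteratedFDeriv ℝ i ((ContinuousLinearMap.compL ℝ E E ℝ).flip ∘ L) x‖ *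
          ‖iteratedFDeriv ℝ (c - i) ((β.postcomp (σ := RingHom.id ℝ) E) ∘ L) x‖ ≤
        (c.choose i : ℝ) * (ε * (‖β‖ * ε)) := by
    intro i hi
    have hi' : i ≤ c := Nat.lt_succ_iff.mp (Finset.mem_range.mp hi)
    rw [mul_assoc]
    refine mul_le_mul_of_nonneg_left ?_ (by positivity)
    exact mul_le_mul (norm_iteratedFDeriv_precomp_comp_le hU hx hL hLb (hi'.trans hc))
      (norm_iteratedFDeriv_postcomp_comp_le β hU hx hL hLb (by omega)) (norm_nonneg _) hε0
  refine (Finset.sum_le_sum hterm).trans ?_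
  rw [← Finset.sum_mul, sum_range_choose_real]
  have h2 : (2 : ℝ) ^ c ≤ 2 ^ 2 := pow_le_pow_right₀ (by norm_num) hc
  have hβε : 0 ≤ ‖β‖ * ε := mul_nonneg (norm_nonneg β) hε0
  calc (2 : ℝ) ^ c * (ε * (‖β‖ * ε)) ≤ 2 ^ 2 * (1 * (‖β‖ * ε)) :=
        mul_le_mul h2 (mul_le_mul_of_nonneg_right hε1 hβε) (by positivity) (by positivity)
    _ = 4 * ‖β‖ * ε := by ring

/-- `‖Dⁿ(f + g + h)(x)‖ ≤ ‖Dⁿ f(x)‖ + ‖Dⁿ g(x)‖ + ‖Dⁿ h(x)‖` for maps `Cⁿ` at `x`. [folklore] -/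
private theorem norm_iteratedFDeriv_add₃_le {F : Type*} [NormedAddCommGroup F] [NormedSpace ℝ F]
    {f g h : E → F} {x : E} {n : ℕ} (hf : ContDiffAt ℝ n f x) (hg : ContDiffAt ℝ n g x)
    (hh : ContDiffAt ℝ n h x) :
    ‖iteratedFDeriv ℝ n (f + g + h) x‖ ≤
      ‖iteratedFDeriv ℝ n f x‖ + ‖iteratedFDeriv ℝ n g x‖ + ‖iteratedFDeriv ℝ n h x‖ := by
  rw [iteratedFDeriv_add_apply (f := f + g) (g := h) (hf.add hg) hh, iteratedFDeriv_add_apply hf hg]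
  exact norm_add₃_le

/-- **Pull-back of a constant form along a `C³`-near-identity map, general real normed space.**
For `P` of class `C³` on an open `U ∋ x` with `‖Dʲ P(x)‖ ≤ ε` (`j = 1, 2, 3`), `0 ≤ ε ≤ 1`, and a
constant field `β`: `‖Dᵐ (bilinPullback (id + P) β − β)(x)‖ ≤ 6 ‖β‖ ε` for `m ≤ 2` (Leibniz rule
for the bilinear pairings and `‖Dʲ(DP)(x)‖ = ‖Dʲ⁺¹ P(x)‖`). [folklore] -/
theorem norm_iteratedFDeriv_bilinPullback_id_add_const_sub_le (β : E →L[ℝ] E →L[ℝ] ℝ)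
    {P : E → E} {U : Set E} {x : E} {ε : ℝ} (hU : IsOpen U) (hx : x ∈ U)
    (hP : ContDiffOn ℝ 3 P U) (hε0 : 0 ≤ ε) (hε1 : ε ≤ 1)
    (hPb : ∀ j, 1 ≤ j → j ≤ 3 → ‖iteratedFDeriv ℝ j P x‖ ≤ ε) {m : ℕ} (hm : m ≤ 2) :
    ‖iteratedFDeriv ℝ m (fun y ↦ bilinPullback (fun z ↦ z + P z) (fun _ ↦ β) y - β) x‖ ≤
      6 * ‖β‖ * ε := by
  set L : E → E →L[ℝ] E := fderiv ℝ P with hL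
  have hUx : U ∈ 𝓝 x := hU.mem_nhds hx
  -- `L = DP` is `C²` on `U` and `‖Dʲ L(x)‖ = ‖Dʲ⁺¹ P(x)‖ ≤ ε` for `j ≤ 2`
  have hLs : ContDiffOn ℝ (2 : ℕ) L U := hP.fderiv_of_isOpen hU (by norm_num)
  have hLb : ∀ j, j ≤ 2 → ‖iteratedFDeriv ℝ j L x‖ ≤ ε := fun j hj ↦ by
    rw [hL, norm_iteratedFDeriv_fderiv_of_isOpen hU hx j]
    exact hPb (j + 1) (by omega) (by omega)
  -- the three terms are `C²` on `U`
  have hΦL : ContDiffOn ℝ (2 : ℕ) ((ContinuousLinearMap.compL ℝ E E ℝ).flip ∘ L) U :=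
    (ContinuousLinearMap.contDiff _).comp_contDiffOn hLs
  have hA : ContDiffOn ℝ (2 : ℕ)
      (fun y ↦ (((ContinuousLinearMap.compL ℝ E E ℝ).flip ∘ L) y).comp β) U :=
    hΦL.clm_comp contDiffOn_const
  have hB : ContDiffOn ℝ (2 : ℕ) ((β.postcomp (σ := RingHom.id ℝ) E) ∘ L) U :=
    (ContinuousLinearMap.contDiff _).comp_contDiffOn hLs
  have hC : ContDiffOn ℝ (2 : ℕ) (fun y ↦ (((ContinuousLinearMap.compL ℝ E E ℝ).flip ∘ L) y).comp
      (((β.postcomp (σ := RingHom.id ℝ) E) ∘ L) y)) U :=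
    hΦL.clm_comp hB
  -- on `U` the function IS the sum of the three terms (`D(id + P) = I + L`)
  have hEq : EqOn (fun y ↦ bilinPullback (fun z ↦ z + P z) (fun _ ↦ β) y - β)
      ((fun y ↦ (((ContinuousLinearMap.compL ℝ E E ℝ).flip ∘ L) y).comp β) +
        (β.postcomp (σ := RingHom.id ℝ) E) ∘ L +
        fun y ↦ (((ContinuousLinearMap.compL ℝ E E ℝ).flip ∘ L) y).comp
          (((β.postcomp (σ := RingHom.id ℝ) E) ∘ L) y)) U := by
    intro y hy
    have hPy : DifferentiableAt ℝ P y :=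
      (hP.contDiffAt (hU.mem_nhds hy)).differentiableAt three_ne_zero
    have hS : fderiv ℝ (fun z ↦ z + P z) y = ContinuousLinearMap.id ℝ E + fderiv ℝ P y :=
      ((hasFDerivAt_id y).add hPy.hasFDerivAt).fderiv
    ext v w
    simp only [bilinPullback_apply, hS, hL, sub_apply, add_apply, Pi.add_apply,
      Function.comp_apply, ContinuousLinearMap.comp_apply, ContinuousLinearMap.flip_apply,
      ContinuousLinearMap.compL_apply, ContinuousLinearMap.postcomp_apply,
      ContinuousLinearMap.coe_id', id_eq, map_add]
    ring
  rw [((Filter.eventuallyEq_of_mem hUx hEq).iteratedFDeriv (𝕜 := ℝ) m).eq_of_nhds]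
  -- assemble: `(1 + 1 + 4) ‖β‖ ε`
  have hm' : (m : WithTop ℕ∞) ≤ (2 : ℕ) := by exact_mod_cast hm
  refine (norm_iteratedFDeriv_add₃_le ((hA.contDiffAt hUx).of_le hm')
    ((hB.contDiffAt hUx).of_le hm') ((hC.contDiffAt hUx).of_le hm')).trans ?_
  refine (add_le_add_three (norm_iteratedFDeriv_precomp_comp_const_le β hU hx hLs hLb hm)
    (norm_iteratedFDeriv_postcomp_comp_le β hU hx hLs hLb hm)
    (norm_iteratedFDeriv_precomp_comp_postcomp_le β hU hx hLs hε0 hε1 hLb hm)).trans_eq ?_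
  ring

end NearIdentity

/-- **Discharge of `BilinPullbackNearIdConst`**: the general estimate
`norm_iteratedFDeriv_bilinPullback_id_add_const_sub_le` on `E4`, and `6 ‖β‖ ε ≤ 8 ‖β‖ ε`.
[folklore] -/
theorem BilinPullbackNearIdConst_holds : BilinPullbackNearIdConst := by
  intro β P U x ε hU hx hP hε0 hε1 hPb m hm
  refine (norm_iteratedFDeriv_bilinPullback_id_add_const_sub_le β hU hx hP hε0 hε1 hPb hm).trans ?_
  nlinarith [mul_nonneg (norm_nonneg β) hε0]

end Literature.Uncategorized
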